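import Literature.NumberTheory.CubicFields.UniformityOverringStep
import Literature.NumberTheory.CubicFields.NotMemUTransfer
import Literature.NumberTheory.Sieve.FriedlanderIwaniecPrimesSquarefreeProofs
import HarnessLib

/-!
# Orbit families with divisibility and non-maximality conditions: the overring recursion behind BTT Prop. 5.1

Topic `Literature/NumberTheory/CubicFields`; built on `UniformityOverringStep.lean` (`InWindow`, `repOf`,
`overOf`/`overOf_spec` — an index-`p` overring of a ring nonmaximal at `p` with `p ∤ ct`, BTT Lemma 2.3 (i);
`indexPOrbits`, `ncard_indexPOrbits_le`, `ncard_indexPImages_le_three`/`le_succ` — Lemma 2.3 (ii): at most `3`,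
resp. `p + 1`, subrings of index `p`; `ncard_le_mul_ncard_of_fibre`, `inWindow_div`, `divBy`) and
`NotMemUTransfer.lean` (non-maximality at `ℓ` is unchanged by operations of index prime to `ℓ`). Everything in
this file is PROVED; the only definitions are the explicit families of orbits.

Bhargava–Taniguchi–Thorne 2023, proof of Prop. 5.1 (p. 16): after the Fourier-transform bounds of Prop. 5.2 one
must count, for a factorisation `q = c₂c₁d₄d₃` into coprime squarefree parts, the `GL₂(ℤ)`-orbits of integral
binary cubic forms `x` with `0 < ±Disc(x) < N` whose ring is: of content divisible by `c₂²c₁`; nonmaximal at each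
`p ∣ d₄` with `p⁴ ∣ Disc`; nonmaximal at each `p ∣ d₃` with `p³ ∥ Disc`. "We begin by replacing each form `x`
with `x/c₂²c₁` … By Lemma 2.3 (i), each ring `R` with `d₄d₃ > 1` is contained in an overring `R'` of index
`d₄d₃` … We count our rings `R` by counting these overrings `R'` with multiplicity given by the number of `R`
thus contained in any such `R'`, which is `≪ q^ε d_{4c}` by Lemma 2.3 (ii)." This file provides the three
counting steps, one prime at a time, for the family

* `divFam s Y m t P₄ P₃` — orbits `O` of forms `f` with `0 < s·Disc f < Y`, `m² ∣ Disc f`, `t ∣ Disc f`,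
  `f ∉ U_p ∧ p⁴ ∣ Disc f` for `p ∈ P₄`, and `f ∉ U_p ∧ p³ ∣ Disc f ∧ p⁴ ∤ Disc f` for `p ∈ P₃`
  (`DivCond`; all conditions are orbit invariants):

* `ncard_sep_isMultiple_le` — **content**: the members with `c ∣ f` (`c` prime to everything) inject into
  the family at height `Y/c⁴` (`f ↦ f/c`);
* `ncard_divFam_P3_step` — **a prime `p ∈ P₃`**: `#divFam ≤ 3 · #divFam(Y/p², t·p, P₃ ∖ p)` (the index-`p`
  overring `R'`, `Disc R = p² Disc R'`, so `p ∣ Disc R'`; `R'` has `p ∤ ct` since `p⁶ ∤ Disc R`, hence at most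
  `3` subrings of index `p`; `p ∣ ct(R)` is excluded by `p⁴ ∤ Disc R`);
* `ncard_divFam_P4_step` — **a prime `p ∈ P₄`**: `#divFam ≤ #divFam(Y/p⁴, P₄ ∖ p) + 3·#divFam(Y/p², m·p, P₄ ∖ p)
  + (p+1)·#divFam(Y/p⁶, P₄ ∖ p)` (the three cases `p ∣ ct(R)`; `R ⊂ R'` of index `p` with `p ∤ ct(R')`, where
  `p² ∣ Disc R'`; `R' = ℤ + pS`).

Non-maximality at the remaining pending primes is carried along by `not_memU_of_ringHom` /
`not_memU_smul_iff`. Then the recursion over all primes: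

* `ncard_divFam_P3_all` — peeling all of `P₃` at once: `#divFam(Y, m, t, P₄, P₃) ≤ 3^{|P₃|} #divFam(Y/d₃², m, t d₃, P₄, ∅)`;
* `abstract_recursion_P4` — the `P₄`-recursion in the abstract (for any quantities obeying the three-case step
  and a terminal bound `A b^{ω(m)} Y/m²` above a threshold `K m^{10}`): the per-prime cost is
  `p⁻⁴ + 3b p⁻⁴ + (p+1) p⁻⁶ ≤ (3b+2) p⁻⁴`, giving `A b^{ω(m)} (3b+2)^{|P₄|} Y/(m² (∏P₄)⁴)` — BTT's exponents `7` at
  `d_{4c}, d_{4n}` after the weights;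
* `DivCountBound C K` — the SHAPE (a predicate) of the terminal count used in the large range `N > Q^{100}`
  (Prop. 4.7 there; derived from Thm 3.2 and Thm 2.4 in `ShintaniDivResidues.lean`).

## References

* M. Bhargava, T. Taniguchi, F. Thorne, *Improved error estimates for the Davenport–Heilbronn theorems*,
  Math. Ann. 389 (2024) = arXiv:2107.12819, Lemma 2.3, §5 (proof of Prop. 5.1) [BhargavaTaniguchiThorne2023].
* M. Bhargava, A. Shankar, J. Tsimerman, *On the Davenport–Heilbronn theorems and second order terms*,
  Invent. Math. 193 (2013), Prop. 23 [BhargavaShankarTsimerman2012].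
-/

noncomputable section

namespace Literature.NumberTheory.CubicFields

open BinaryCubic RingOfForm

/-! ### The family -/

/-- The conditions defining the family: window, `m² ∣ Disc`, `t ∣ Disc`, and at the pending primes
`p ∈ P₄`: `f ∉ U_p`, `p⁴ ∣ Disc`; `p ∈ P₃`: `f ∉ U_p`, `p³ ∣ Disc`, `p⁴ ∤ Disc`. [cite: BhargavaTaniguchiThorne2023, §5 (proof of Prop. 5.1: the conditions at the primes of d₄, d₃)] -/
def DivCond (s : ℤ) (Y : ℝ) (m t : ℕ) (P4 P3 : Finset ℕ) (f : BinaryCubic ℤ) : Prop :=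
  InWindow s Y f.disc ∧ ((m : ℕ) : ℤ) ^ 2 ∣ f.disc ∧ ((t : ℕ) : ℤ) ∣ f.disc ∧
    (∀ p ∈ P4, ¬ f.MemU p ∧ (p : ℤ) ^ 4 ∣ f.disc) ∧
    (∀ p ∈ P3, ¬ f.MemU p ∧ (p : ℤ) ^ 3 ∣ f.disc ∧ ¬ (p : ℤ) ^ 4 ∣ f.disc)

/-- **The family `divFam s Y m t P₄ P₃`** of `GL₂(ℤ)`-orbits of integral binary cubic forms satisfying `DivCond`.
[cite: BhargavaTaniguchiThorne2023, §5 (proof of Prop. 5.1: the orbits x' with |Disc x'| < N/…, d² ∣ Disc x', nonmaximal at d₄d₃)] -/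
def divFam (s : ℤ) (Y : ℝ) (m t : ℕ) (P4 P3 : Finset ℕ) : Set (Set (BinaryCubic ℤ)) :=
  {O | ∃ f : BinaryCubic ℤ, O = gl2zOrbit f ∧ DivCond s Y m t P4 P3 f}

variable {s : ℤ} {Y : ℝ} {m t : ℕ} {P4 P3 : Finset ℕ}

/-- The conditions are orbit invariants. [folklore] -/
theorem DivCond.of_gl2zEquiv {f g : BinaryCubic ℤ} (h : GL2ZEquiv f g) (hf : DivCond s Y m t P4 P3 f) :
    DivCond s Y m t P4 P3 g := by
  obtain ⟨hw, hm, ht, h4, h3⟩ := hf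
  unfold DivCond
  rw [h.disc_eq]
  exact ⟨hw, hm, ht, fun p hp => ⟨fun hg => (h4 p hp).1 (hg.of_gl2zEquiv h.symm), (h4 p hp).2⟩,
    fun p hp => ⟨fun hg => (h3 p hp).1 (hg.of_gl2zEquiv h.symm), (h3 p hp).2⟩⟩

/-- The conditions only get weaker as `Y` grows. [folklore] -/
theorem DivCond.mono {Y' : ℝ} (hY : Y ≤ Y') {f : BinaryCubic ℤ} (hf : DivCond s Y m t P4 P3 f) :
    DivCond s Y' m t P4 P3 f :=
  ⟨⟨hf.1.1, hf.1.2.trans_le hY⟩, hf.2⟩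

/-- The conditions hold for the representative of a member. [folklore] -/
theorem repOf_of_mem_divFam {O : Set (BinaryCubic ℤ)} (hO : O ∈ divFam s Y m t P4 P3) :
    O = gl2zOrbit (repOf O) ∧ DivCond s Y m t P4 P3 (repOf O) := by
  obtain ⟨f, hO', hf⟩ := hO
  have he : GL2ZEquiv f (repOf O) := by
    have := gl2zEquiv_repOf f; rwa [← hO'] at this
  exact ⟨eq_gl2zOrbit_repOf ⟨f, hO'⟩, hf.of_gl2zEquiv he⟩

/-- The family is finite (a window of discriminants). [folklore] -/
theorem divFam_finite (s : ℤ) (Y : ℝ) (m t : ℕ) (P4 P3 : Finset ℕ) : (divFam s Y m t P4 P3).Finite :=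
  (finite_setOf_inWindow s Y).subset fun _ ⟨f, hO, hf⟩ => ⟨f, hO, hf.1⟩

/-- The family grows with `Y`. [folklore] -/
theorem divFam_mono {Y' : ℝ} (hY : Y ≤ Y') : divFam s Y m t P4 P3 ⊆ divFam s Y' m t P4 P3 :=
  fun _ ⟨f, hO, hf⟩ => ⟨f, hO, hf.mono hY⟩

/-- Hence its size is monotone in `Y`. [folklore] -/
theorem ncard_divFam_mono {Y' : ℝ} (hY : Y ≤ Y') : (divFam s Y m t P4 P3).ncard ≤ (divFam s Y' m t P4 P3).ncard :=
  Set.ncard_le_ncard (divFam_mono hY) (divFam_finite _ _ _ _ _ _)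

/-- Forgetting pending primes of `P₃` enlarges the family. [folklore] -/
theorem divFam_subset_of_subset_P3 {P3' : Finset ℕ} (h : P3' ⊆ P3) : divFam s Y m t P4 P3 ⊆ divFam s Y m t P4 P3' :=
  fun _ ⟨f, hO, hw, hm, ht, h4, h3⟩ => ⟨f, hO, hw, hm, ht, h4, fun p hp => h3 p (h hp)⟩

/-! ### Transfer of the conditions along `Disc f = c · Disc g` -/

/-- **Transfer.** If `Disc f = c · Disc g` with `c > 0` prime to `m`, `t` and to the pending primes, and
non-maximality at every prime `ℓ ∤ c` passes from `f` to `g`, then the conditions for `f` at height `Y` give the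
conditions for `g` at height `Y/c`. [folklore] -/
theorem DivCond.transfer {c : ℕ} (hc : 0 < c) {f g : BinaryCubic ℤ} (hdisc : f.disc = (c : ℤ) * g.disc)
    (hU : ∀ ℓ : ℕ, ℓ.Prime → ¬ ℓ ∣ c → ¬ f.MemU ℓ → ¬ g.MemU ℓ)
    (hcm : c.Coprime m) (hct : c.Coprime t) (hP4 : ∀ ℓ ∈ P4, ℓ.Prime ∧ ¬ ℓ ∣ c) (hP3 : ∀ ℓ ∈ P3, ℓ.Prime ∧ ¬ ℓ ∣ c)
    (hf : DivCond s Y m t P4 P3 f) : DivCond s (Y / (c : ℝ)) m t P4 P3 g := by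
  obtain ⟨hw, hm, ht, h4, h3⟩ := hf
  have cop : ∀ {a : ℕ}, c.Coprime a → ∀ n : ℕ, ((a : ℕ) : ℤ) ^ n ∣ f.disc → ((a : ℕ) : ℤ) ^ n ∣ g.disc := by
    intro a hca n h
    rw [hdisc] at h
    exact ((Nat.isCoprime_iff_coprime.mpr hca.symm).pow_left).dvd_of_dvd_mul_left h
  refine ⟨inWindow_div hc hdisc hw, cop hcm 2 hm, ?_, fun ℓ hℓ => ?_, fun ℓ hℓ => ?_⟩
  · have := cop hct 1 (by simpa using ht); simpa using this
  · obtain ⟨hℓp, hℓc⟩ := hP4 ℓ hℓ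
    exact ⟨hU ℓ hℓp hℓc (h4 ℓ hℓ).1, cop ((Nat.Prime.coprime_iff_not_dvd hℓp).mpr hℓc).symm 4 (h4 ℓ hℓ).2⟩
  · obtain ⟨hℓp, hℓc⟩ := hP3 ℓ hℓ
    refine ⟨hU ℓ hℓp hℓc (h3 ℓ hℓ).1, cop ((Nat.Prime.coprime_iff_not_dvd hℓp).mpr hℓc).symm 3 (h3 ℓ hℓ).2.1,
      fun h => (h3 ℓ hℓ).2.2 ?_⟩
    rw [hdisc]; exact dvd_mul_of_dvd_right h _

/-- Along division by `c`: `f = c·g`, `Disc f = c⁴ Disc g`, `c·g ∉ U_ℓ ↔ g ∉ U_ℓ` for `ℓ ∤ c`. [folklore] -/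
theorem DivCond.transfer_smul {c : ℕ} (hc : 0 < c) {g : BinaryCubic ℤ}
    (hcm : c.Coprime m) (hct : c.Coprime t) (hP4 : ∀ ℓ ∈ P4, ℓ.Prime ∧ ¬ ℓ ∣ c) (hP3 : ∀ ℓ ∈ P3, ℓ.Prime ∧ ¬ ℓ ∣ c)
    (hf : DivCond s Y m t P4 P3 ((c : ℤ) • g)) : DivCond s (Y / (c : ℝ) ^ 4) m t P4 P3 g := by
  have h := DivCond.transfer (c := c ^ 4) (pow_pos hc 4) (g := g) (by rw [disc_smul]; push_cast; ring)
    (fun ℓ hℓ hℓc h => (not_memU_smul_iff hℓ (fun h' => hℓc ?_) g).mp h)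
    (hcm.pow_left 4) (hct.pow_left 4)
    (fun ℓ hℓ => ⟨(hP4 ℓ hℓ).1, fun h' => (hP4 ℓ hℓ).2 ((hP4 ℓ hℓ).1.dvd_of_dvd_pow h')⟩)
    (fun ℓ hℓ => ⟨(hP3 ℓ hℓ).1, fun h' => (hP3 ℓ hℓ).2 ((hP3 ℓ hℓ).1.dvd_of_dvd_pow h')⟩) hf
  · simpa [Nat.cast_pow] using h
  · exact dvd_pow (Int.natCast_dvd_natCast.mp h') four_ne_zero

/-- Along a ring homomorphism `φ : R(f) → R(g)` with `|detOnQuot φ| = p`: `Disc f = p² Disc g` and non-maximality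
at every prime `ℓ ≠ p` passes to `g`. [folklore] -/
theorem DivCond.transfer_ringHom {p : ℕ} (hp : p.Prime) {f g : BinaryCubic ℤ} (φ : RingOfForm f →+* RingOfForm g)
    (hφ : Function.Injective φ) (hdet : (detOnQuot φ).natAbs = p)
    (hpm : p.Coprime m) (hpt : p.Coprime t) (hP4 : ∀ ℓ ∈ P4, ℓ.Prime ∧ ℓ ≠ p) (hP3 : ∀ ℓ ∈ P3, ℓ.Prime ∧ ℓ ≠ p)
    (hf : DivCond s Y m t P4 P3 f) : DivCond s (Y / (p : ℝ) ^ 2) m t P4 P3 g := by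
  have hdisc : f.disc = ((p ^ 2 : ℕ) : ℤ) * g.disc := by
    rw [disc_eq_detOnQuot_sq_mul φ hφ, ← Int.natAbs_sq (detOnQuot φ), hdet, Nat.cast_pow]
  have hne : ∀ {ℓ : ℕ}, ℓ.Prime → ℓ ≠ p → ¬ ℓ ∣ p ^ 2 := fun hℓ hne h =>
    hne ((Nat.prime_dvd_prime_iff_eq hℓ hp).mp (hℓ.dvd_of_dvd_pow h))
  have h := DivCond.transfer (c := p ^ 2) (pow_pos hp.pos 2) hdisc
    (fun ℓ hℓ hℓc h => not_memU_of_ringHom hℓ φ (fun hd => hℓc ?_) h)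
    (hpm.pow_left 2) (hpt.pow_left 2)
    (fun ℓ hℓ => ⟨(hP4 ℓ hℓ).1, hne (hP4 ℓ hℓ).1 (hP4 ℓ hℓ).2⟩)
    (fun ℓ hℓ => ⟨(hP3 ℓ hℓ).1, hne (hP3 ℓ hℓ).1 (hP3 ℓ hℓ).2⟩) hf
  · simpa [Nat.cast_pow] using h
  · have h1 : ℓ ∣ (detOnQuot φ).natAbs := Int.natCast_dvd.mp hd
    rw [hdet] at h1
    exact h1.trans (dvd_pow_self p two_ne_zero)

/-! ### Content: dividing by `c` -/

/-- **Content division**: the members of the family whose form is a multiple of `c` (`c > 0` prime to `m`, `t`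
and the pending primes) inject, by `f ↦ f/c`, into the family at height `Y/c⁴` ("replacing each form `x` with
`x/c₂²c₁`, using the natural bijection … with forms `x` with `|Disc(x)| < N c₂⁻⁸c₁⁻⁴`").
[cite: BhargavaTaniguchiThorne2023, §5 (proof of Prop. 5.1: x ↦ x/(c₂²c₁))] -/
theorem ncard_sep_isMultiple_le {c : ℕ} (hc : 0 < c) (hcm : c.Coprime m) (hct : c.Coprime t)
    (hP4 : ∀ ℓ ∈ P4, ℓ.Prime ∧ ¬ ℓ ∣ c) (hP3 : ∀ ℓ ∈ P3, ℓ.Prime ∧ ¬ ℓ ∣ c) :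
    {O ∈ divFam s Y m t P4 P3 | (repOf O).IsMultiple c}.ncard ≤ (divFam s (Y / (c : ℝ) ^ 4) m t P4 P3).ncard := by
  refine Set.ncard_le_ncard_of_injOn (fun O => gl2zOrbit ((repOf O).divBy c)) ?_ ?_ (divFam_finite _ _ _ _ _ _)
  · rintro O ⟨hO, hmul⟩
    obtain ⟨-, hc'⟩ := repOf_of_mem_divFam hO
    have hf : repOf O = (c : ℤ) • (repOf O).divBy c := eq_smul_divBy hmul
    rw [hf] at hc'
    exact ⟨_, rfl, hc'.transfer_smul hc hcm hct hP4 hP3⟩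
  · rintro O₁ ⟨hO₁, hm₁⟩ O₂ ⟨hO₂, hm₂⟩ h
    have h' : GL2ZEquiv ((repOf O₁).divBy c) ((repOf O₂).divBy c) := gl2zOrbit_eq_iff.mp h
    have h'' := h'.smul (c : ℤ)
    rw [← eq_smul_divBy hm₁, ← eq_smul_divBy hm₂] at h''
    exact (repOf_of_mem_divFam hO₁).1.trans ((gl2zOrbit_eq_iff.mpr h'').trans (repOf_of_mem_divFam hO₂).1.symm)

/-! ### The step at a prime of `P₃` -/

section Steps

variable (p : ℕ) [hp : Fact p.Prime]

omit hp in
/-- At `p ∈ P₃` the representative is nonmaximal at `p`, not a multiple of `p`, and `p⁴ ∤ Disc`. [folklore] -/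
theorem repOf_P3 {O : Set (BinaryCubic ℤ)} (hO : O ∈ divFam s Y m t P4 P3) (hpP3 : p ∈ P3) :
    ¬ (repOf O).MemU p ∧ ¬ (repOf O).IsMultiple p ∧ ¬ (p : ℤ) ^ 4 ∣ (repOf O).disc := by
  obtain ⟨-, hc⟩ := repOf_of_mem_divFam hO
  obtain ⟨hU, -, h4⟩ := hc.2.2.2.2 p hpP3
  refine ⟨hU, fun hm => h4 ?_, h4⟩
  obtain ⟨g, hg⟩ := isMultiple_iff_exists_smul.mp hm
  rw [hg, disc_smul]
  exact dvd_mul_right _ _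

/-- **`p ∈ P₃`: the overring map** `O ↦ orbit(R')`, `R'` the index-`p` overring, lands in the family at height
`Y/p²` with `t` replaced by `t·p` (`p³ ∣ Disc R = p² Disc R'`). [folklore] -/
theorem mapsTo_P3 (hP4 : ∀ ℓ ∈ P4, ℓ.Prime) (hP3 : ∀ ℓ ∈ P3, ℓ.Prime) (hpP3 : p ∈ P3) (hpP4 : p ∉ P4)
    (hpm : p.Coprime m) (hpt : p.Coprime t) :
    ∀ O ∈ divFam s Y m t P4 P3, gl2zOrbit (overOf p O) ∈ divFam s (Y / (p : ℝ) ^ 2) m (t * p) P4 (P3.erase p) := by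
  intro O hO
  obtain ⟨-, hc⟩ := repOf_of_mem_divFam hO
  obtain ⟨hU, hnm, -⟩ := repOf_P3 p hO hpP3
  obtain ⟨φ, hφ, hdet⟩ := overOf_spec p hU hnm
  have hp3 : (p : ℤ) ^ 3 ∣ (repOf O).disc := (hc.2.2.2.2 p hpP3).2.1
  have hc' : DivCond s Y m t P4 (P3.erase p) (repOf O) :=
    ⟨hc.1, hc.2.1, hc.2.2.1, hc.2.2.2.1, fun ℓ hℓ => hc.2.2.2.2 ℓ (Finset.mem_of_mem_erase hℓ)⟩
  have key := hc'.transfer_ringHom hp.out φ hφ hdet hpm hpt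
    (fun ℓ hℓ => ⟨hP4 ℓ hℓ, fun h => hpP4 (h ▸ hℓ)⟩)
    (fun ℓ hℓ => ⟨hP3 ℓ (Finset.mem_of_mem_erase hℓ), Finset.ne_of_mem_erase hℓ⟩)
  refine ⟨overOf p O, rfl, key.1, key.2.1, ?_, key.2.2.2⟩
  -- `t · p ∣ Disc R'`
  have hdisc : (repOf O).disc = (p : ℤ) ^ 2 * (overOf p O).disc := by
    rw [disc_eq_detOnQuot_sq_mul φ hφ, ← Int.natAbs_sq (detOnQuot φ), hdet]
  have hpd : (p : ℤ) ∣ (overOf p O).disc := by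
    have h3 : (p : ℤ) ^ 2 * p ∣ (p : ℤ) ^ 2 * (overOf p O).disc := by rw [← pow_succ, ← hdisc]; exact hp3
    exact (mul_dvd_mul_iff_left (pow_ne_zero 2 (by exact_mod_cast hp.out.ne_zero))).mp h3
  push_cast
  exact (Nat.isCoprime_iff_coprime.mpr hpt.symm).mul_dvd key.2.2.1 hpd

/-- **`p ∈ P₃`: fibres have at most `3` elements** — the orbits over `orbit(k)` are classes of index-`p` subrings of
`R(k)`, and `p ∤ ct(k)` (else `p⁶ ∣ Disc R`). [folklore] -/
theorem fibre_P3 (hpP3 : p ∈ P3) {b : Set (BinaryCubic ℤ)} (hb : ∃ k, b = gl2zOrbit k) :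
    {O ∈ divFam s Y m t P4 P3 | gl2zOrbit (overOf p O) = b}.ncard ≤ 3 := by
  set F := {O ∈ divFam s Y m t P4 P3 | gl2zOrbit (overOf p O) = b}
  rcases F.eq_empty_or_nonempty with hF | ⟨O₀, hO₀⟩
  · rw [hF, Set.ncard_empty]; exact Nat.zero_le _
  have hbk : b = gl2zOrbit (repOf b) := eq_gl2zOrbit_repOf hb
  have hequiv : ∀ O ∈ F, GL2ZEquiv (overOf p O) (repOf b) := fun O hO => gl2zOrbit_eq_iff.mp (hO.2.trans hbk)
  have hk : ¬ (repOf b).IsMultiple p := by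
    intro h
    have h' : (overOf p O₀).IsMultiple p := h.of_gl2zEquiv (hequiv O₀ hO₀).symm
    obtain ⟨hU, hnm, h4⟩ := repOf_P3 p hO₀.1 hpP3
    obtain ⟨φ, hφ, hdet⟩ := overOf_spec p hU hnm
    apply h4
    obtain ⟨g, hg⟩ := isMultiple_iff_exists_smul.mp h'
    rw [disc_eq_detOnQuot_sq_mul φ hφ, ← Int.natAbs_sq (detOnQuot φ), hdet, hg, disc_smul]
    exact ⟨(p : ℤ) ^ 2 * g.disc, by ring⟩
  calc F.ncard ≤ (indexPOrbits (repOf b) p).ncard := Set.ncard_le_ncard (fun O hO => ?_)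
        (Set.Finite.of_injOn (mapsTo_imageIn _ p) (injOn_imageIn _ p) (indexPImages_finite _ p))
    _ ≤ (indexPImages (repOf b) p).ncard := ncard_indexPOrbits_le _ p
    _ ≤ 3 := ncard_indexPImages_le_three hk
  obtain ⟨hrep, -⟩ := repOf_of_mem_divFam hO.1
  obtain ⟨hU, hnm, -⟩ := repOf_P3 p hO.1 hpP3
  obtain ⟨φ, hφ, hdet⟩ := overOf_spec p hU hnm
  exact hrep ▸ mem_indexPOrbits_of_gl2zEquiv φ hφ hdet (hequiv O hO)

/-- **The step at `p ∈ P₃`: `#divFam(Y, t, P₃) ≤ 3 · #divFam(Y/p², t·p, P₃ ∖ p)`.**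
[cite: BhargavaTaniguchiThorne2023, §5 with Lemma 2.3 (proof of Prop. 5.1: the primes of d₃)] -/
theorem ncard_divFam_P3_step (hP4 : ∀ ℓ ∈ P4, ℓ.Prime) (hP3 : ∀ ℓ ∈ P3, ℓ.Prime) (hpP3 : p ∈ P3) (hpP4 : p ∉ P4)
    (hpm : p.Coprime m) (hpt : p.Coprime t) :
    (divFam s Y m t P4 P3).ncard ≤ 3 * (divFam s (Y / (p : ℝ) ^ 2) m (t * p) P4 (P3.erase p)).ncard :=
  ncard_le_mul_ncard_of_fibre (divFam_finite _ _ _ _ _ _) (divFam_finite _ _ _ _ _ _) _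
    (mapsTo_P3 p hP4 hP3 hpP3 hpP4 hpm hpt) 3 fun _ hb => fibre_P3 p hpP3 (hb.imp fun _ h => h.1)

/-! ### The step at a prime of `P₄` -/

omit hp in
/-- At `p ∈ P₄` the representative is nonmaximal at `p`. [folklore] -/
theorem repOf_P4 {O : Set (BinaryCubic ℤ)} (hO : O ∈ divFam s Y m t P4 P3) (hpP4 : p ∈ P4) :
    ¬ (repOf O).MemU p :=
  ((repOf_of_mem_divFam hO).2.2.2.2.1 p hpP4).1

omit hp in
/-- Dropping `p` from `P₄`. [folklore] -/
theorem divCond_erase_P4 {f : BinaryCubic ℤ} (hf : DivCond s Y m t P4 P3 f) : DivCond s Y m t (P4.erase p) P3 f :=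
  ⟨hf.1, hf.2.1, hf.2.2.1, fun ℓ hℓ => hf.2.2.2.1 ℓ (Finset.mem_of_mem_erase hℓ), hf.2.2.2.2⟩

/-- **`p ∈ P₄`, case `p ∣ ct`**: `O ↦ orbit(f/p)` lands in the family at `Y/p⁴`. [folklore] -/
theorem mapsTo_P4_multiple (hP4 : ∀ ℓ ∈ P4, ℓ.Prime) (hP3 : ∀ ℓ ∈ P3, ℓ.Prime) (hpP3 : p ∉ P3)
    (hpm : p.Coprime m) (hpt : p.Coprime t) :
    ∀ O ∈ {O ∈ divFam s Y m t P4 P3 | (repOf O).IsMultiple p},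
      gl2zOrbit ((repOf O).divBy p) ∈ divFam s (Y / (p : ℝ) ^ 4) m t (P4.erase p) P3 := by
  rintro O ⟨hO, hmul⟩
  obtain ⟨-, hc⟩ := repOf_of_mem_divFam hO
  have hf : repOf O = (p : ℤ) • (repOf O).divBy p := eq_smul_divBy hmul
  have hc' := divCond_erase_P4 p hc
  rw [hf] at hc'
  refine ⟨_, rfl, hc'.transfer_smul hp.out.pos hpm hpt ?_ ?_⟩
  · exact fun ℓ hℓ => ⟨hP4 ℓ (Finset.mem_of_mem_erase hℓ), fun h =>
      Finset.ne_of_mem_erase hℓ ((Nat.prime_dvd_prime_iff_eq (hP4 ℓ (Finset.mem_of_mem_erase hℓ)) hp.out).mp h)⟩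
  · exact fun ℓ hℓ => ⟨hP3 ℓ hℓ, fun h => hpP3 (((Nat.prime_dvd_prime_iff_eq (hP3 ℓ hℓ) hp.out).mp h) ▸ hℓ)⟩

omit hp in
/-- **`p ∈ P₄`, case `p ∣ ct`**: the map is injective. [folklore] -/
theorem injOn_P4_multiple :
    Set.InjOn (fun O => gl2zOrbit ((repOf O).divBy p)) {O ∈ divFam s Y m t P4 P3 | (repOf O).IsMultiple p} := by
  rintro O₁ ⟨hO₁, hm₁⟩ O₂ ⟨hO₂, hm₂⟩ h
  have h' : GL2ZEquiv ((repOf O₁).divBy p) ((repOf O₂).divBy p) := gl2zOrbit_eq_iff.mp h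
  have h'' := h'.smul (p : ℤ)
  rw [← eq_smul_divBy hm₁, ← eq_smul_divBy hm₂] at h''
  exact (repOf_of_mem_divFam hO₁).1.trans ((gl2zOrbit_eq_iff.mpr h'').trans (repOf_of_mem_divFam hO₂).1.symm)

/-- **`p ∈ P₄`, case `p ∤ ct`, overring primitive at `p`**: `O ↦ orbit(R')` lands in the family at `Y/p²` with
`m` replaced by `m·p` (`p⁴ ∣ Disc R = p² Disc R'`). [folklore] -/
theorem mapsTo_P4_prim (hP4 : ∀ ℓ ∈ P4, ℓ.Prime) (hP3 : ∀ ℓ ∈ P3, ℓ.Prime) (hpP4 : p ∈ P4) (hpP3 : p ∉ P3)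
    (hpm : p.Coprime m) (hpt : p.Coprime t) :
    ∀ O ∈ {O ∈ divFam s Y m t P4 P3 | ¬ (repOf O).IsMultiple p ∧ ¬ (overOf p O).IsMultiple p},
      gl2zOrbit (overOf p O) ∈ divFam s (Y / (p : ℝ) ^ 2) (m * p) t (P4.erase p) P3 := by
  rintro O ⟨hO, hnm, -⟩
  obtain ⟨-, hc⟩ := repOf_of_mem_divFam hO
  obtain ⟨φ, hφ, hdet⟩ := overOf_spec p (repOf_P4 p hO hpP4) hnm
  have hp4 : (p : ℤ) ^ 4 ∣ (repOf O).disc := (hc.2.2.2.1 p hpP4).2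
  have key := (divCond_erase_P4 p hc).transfer_ringHom hp.out φ hφ hdet hpm hpt
    (fun ℓ hℓ => ⟨hP4 ℓ (Finset.mem_of_mem_erase hℓ), Finset.ne_of_mem_erase hℓ⟩)
    (fun ℓ hℓ => ⟨hP3 ℓ hℓ, fun h => hpP3 (h ▸ hℓ)⟩)
  refine ⟨overOf p O, rfl, key.1, ?_, key.2.2⟩
  -- `(m p)² ∣ Disc R'`
  have hdisc : (repOf O).disc = (p : ℤ) ^ 2 * (overOf p O).disc := by
    rw [disc_eq_detOnQuot_sq_mul φ hφ, ← Int.natAbs_sq (detOnQuot φ), hdet]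
  have hpd : (p : ℤ) ^ 2 ∣ (overOf p O).disc := by
    have h4 : (p : ℤ) ^ 2 * (p : ℤ) ^ 2 ∣ (p : ℤ) ^ 2 * (overOf p O).disc := by rw [← pow_add, ← hdisc]; exact hp4
    exact (mul_dvd_mul_iff_left (pow_ne_zero 2 (by exact_mod_cast hp.out.ne_zero))).mp h4
  push_cast
  rw [mul_pow]
  exact ((Nat.isCoprime_iff_coprime.mpr hpm.symm).pow).mul_dvd key.2.1 hpd

/-- **`p ∈ P₄`, case `p ∤ ct`, overring primitive: fibres have at most `3` elements.** [folklore] -/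
theorem fibre_P4_prim (hpP4 : p ∈ P4) {b : Set (BinaryCubic ℤ)} (hb : ∃ k, b = gl2zOrbit k) :
    {O ∈ {O ∈ divFam s Y m t P4 P3 | ¬ (repOf O).IsMultiple p ∧ ¬ (overOf p O).IsMultiple p} |
      gl2zOrbit (overOf p O) = b}.ncard ≤ 3 := by
  set F := {O ∈ {O ∈ divFam s Y m t P4 P3 | ¬ (repOf O).IsMultiple p ∧ ¬ (overOf p O).IsMultiple p} |
      gl2zOrbit (overOf p O) = b}
  rcases F.eq_empty_or_nonempty with hF | ⟨O₀, hO₀⟩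
  · rw [hF, Set.ncard_empty]; exact Nat.zero_le _
  have hbk : b = gl2zOrbit (repOf b) := eq_gl2zOrbit_repOf hb
  have hequiv : ∀ O ∈ F, GL2ZEquiv (overOf p O) (repOf b) := fun O hO => gl2zOrbit_eq_iff.mp (hO.2.trans hbk)
  have hk : ¬ (repOf b).IsMultiple p := fun h => hO₀.1.2.2 (h.of_gl2zEquiv (hequiv O₀ hO₀).symm)
  calc F.ncard ≤ (indexPOrbits (repOf b) p).ncard := Set.ncard_le_ncard (fun O hO => ?_)
        (Set.Finite.of_injOn (mapsTo_imageIn _ p) (injOn_imageIn _ p) (indexPImages_finite _ p))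
    _ ≤ (indexPImages (repOf b) p).ncard := ncard_indexPOrbits_le _ p
    _ ≤ 3 := ncard_indexPImages_le_three hk
  obtain ⟨hrep, -⟩ := repOf_of_mem_divFam hO.1.1
  obtain ⟨φ, hφ, hdet⟩ := overOf_spec p (repOf_P4 p hO.1.1 hpP4) hO.1.2.1
  exact hrep ▸ mem_indexPOrbits_of_gl2zEquiv φ hφ hdet (hequiv O hO)

/-- **`p ∈ P₄`, case `p ∤ ct`, overring `ℤ + pS`**: `O ↦ orbit(S)` lands in the family at `Y/p⁶`. [folklore] -/
theorem mapsTo_P4_imprim (hP4 : ∀ ℓ ∈ P4, ℓ.Prime) (hP3 : ∀ ℓ ∈ P3, ℓ.Prime) (hpP4 : p ∈ P4) (hpP3 : p ∉ P3)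
    (hpm : p.Coprime m) (hpt : p.Coprime t) :
    ∀ O ∈ {O ∈ divFam s Y m t P4 P3 | ¬ (repOf O).IsMultiple p ∧ (overOf p O).IsMultiple p},
      gl2zOrbit ((overOf p O).divBy p) ∈ divFam s (Y / (p : ℝ) ^ 6) m t (P4.erase p) P3 := by
  rintro O ⟨hO, hnm, hmul⟩
  obtain ⟨-, hc⟩ := repOf_of_mem_divFam hO
  obtain ⟨φ, hφ, hdet⟩ := overOf_spec p (repOf_P4 p hO hpP4) hnm
  have hP4' : ∀ ℓ ∈ P4.erase p, ℓ.Prime ∧ ℓ ≠ p := fun ℓ hℓ => ⟨hP4 ℓ (Finset.mem_of_mem_erase hℓ), Finset.ne_of_mem_erase hℓ⟩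
  have hP3' : ∀ ℓ ∈ P3, ℓ.Prime ∧ ℓ ≠ p := fun ℓ hℓ => ⟨hP3 ℓ hℓ, fun h => hpP3 (h ▸ hℓ)⟩
  have key := (divCond_erase_P4 p hc).transfer_ringHom hp.out φ hφ hdet hpm hpt hP4' hP3'
  have hg : overOf p O = (p : ℤ) • (overOf p O).divBy p := eq_smul_divBy hmul
  rw [hg] at key
  have key2 := key.transfer_smul hp.out.pos hpm hpt
    (fun ℓ hℓ => ⟨(hP4' ℓ hℓ).1, fun h => (hP4' ℓ hℓ).2 ((Nat.prime_dvd_prime_iff_eq (hP4' ℓ hℓ).1 hp.out).mp h)⟩)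
    (fun ℓ hℓ => ⟨(hP3' ℓ hℓ).1, fun h => (hP3' ℓ hℓ).2 ((Nat.prime_dvd_prime_iff_eq (hP3' ℓ hℓ).1 hp.out).mp h)⟩)
  refine ⟨_, rfl, ?_⟩
  rw [div_div, ← pow_add] at key2
  exact key2

/-- **`p ∈ P₄`, case `ℤ + pS`: fibres have at most `p + 1` elements** (classes of index-`p` subrings of
`R(p·k)`). [folklore] -/
theorem fibre_P4_imprim (hpP4 : p ∈ P4) {b : Set (BinaryCubic ℤ)} (hb : ∃ k, b = gl2zOrbit k) :
    {O ∈ {O ∈ divFam s Y m t P4 P3 | ¬ (repOf O).IsMultiple p ∧ (overOf p O).IsMultiple p} |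
      gl2zOrbit ((overOf p O).divBy p) = b}.ncard ≤ p + 1 := by
  set F := {O ∈ {O ∈ divFam s Y m t P4 P3 | ¬ (repOf O).IsMultiple p ∧ (overOf p O).IsMultiple p} |
      gl2zOrbit ((overOf p O).divBy p) = b}
  have hbk : b = gl2zOrbit (repOf b) := eq_gl2zOrbit_repOf hb
  have hequiv : ∀ O ∈ F, GL2ZEquiv (overOf p O) ((p : ℤ) • repOf b) := fun O hO => by
    have h := (gl2zOrbit_eq_iff.mp (hO.2.trans hbk)).smul (p : ℤ)
    rwa [← eq_smul_divBy hO.1.2.2] at h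
  calc F.ncard ≤ (indexPOrbits ((p : ℤ) • repOf b) p).ncard :=
        Set.ncard_le_ncard (fun O hO => ?_) (Set.Finite.of_injOn (mapsTo_imageIn _ p) (injOn_imageIn _ p) (indexPImages_finite _ p))
    _ ≤ (indexPImages ((p : ℤ) • repOf b) p).ncard := ncard_indexPOrbits_le _ p
    _ ≤ p + 1 := ncard_indexPImages_le_succ _ p
  obtain ⟨hrep, -⟩ := repOf_of_mem_divFam hO.1.1
  obtain ⟨φ, hφ, hdet⟩ := overOf_spec p (repOf_P4 p hO.1.1 hpP4) hO.1.2.1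
  exact hrep ▸ mem_indexPOrbits_of_gl2zEquiv φ hφ hdet (hequiv O hO)

/-- **The step at `p ∈ P₄`:
`#divFam(Y, m, P₄) ≤ #divFam(Y/p⁴, m, P₄ ∖ p) + 3·#divFam(Y/p², m·p, P₄ ∖ p) + (p+1)·#divFam(Y/p⁶, m, P₄ ∖ p)`**
(the three cases `p ∣ ct`; index-`p` overring with `p ∤ ct`; index-`p` overring `ℤ + pS`).
[cite: BhargavaTaniguchiThorne2023, §5 with Lemma 2.3 (proof of Prop. 5.1: the primes of d₄ = d_{4c} d_{4n})] -/
theorem ncard_divFam_P4_step (hP4 : ∀ ℓ ∈ P4, ℓ.Prime) (hP3 : ∀ ℓ ∈ P3, ℓ.Prime) (hpP4 : p ∈ P4) (hpP3 : p ∉ P3)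
    (hpm : p.Coprime m) (hpt : p.Coprime t) :
    (divFam s Y m t P4 P3).ncard ≤
      (divFam s (Y / (p : ℝ) ^ 4) m t (P4.erase p) P3).ncard +
      3 * (divFam s (Y / (p : ℝ) ^ 2) (m * p) t (P4.erase p) P3).ncard +
      (p + 1) * (divFam s (Y / (p : ℝ) ^ 6) m t (P4.erase p) P3).ncard := by
  have hfin := divFam_finite s Y m t P4 P3
  refine (ncard_le_of_subset_union₃
    {O ∈ divFam s Y m t P4 P3 | (repOf O).IsMultiple p}
    {O ∈ divFam s Y m t P4 P3 | ¬ (repOf O).IsMultiple p ∧ ¬ (overOf p O).IsMultiple p}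
    {O ∈ divFam s Y m t P4 P3 | ¬ (repOf O).IsMultiple p ∧ (overOf p O).IsMultiple p}
    hfin (Set.sep_subset _ _) (Set.sep_subset _ _) (Set.sep_subset _ _) fun O hO => ?_).trans
    (Nat.add_le_add (Nat.add_le_add ?_ ?_) ?_)
  · by_cases h2 : (repOf O).IsMultiple p
    · exact Or.inl (Or.inl ⟨hO, h2⟩)
    · by_cases h3 : (overOf p O).IsMultiple p
      · exact Or.inr ⟨hO, h2, h3⟩
      · exact Or.inl (Or.inr ⟨hO, h2, h3⟩)
  · exact Set.ncard_le_ncard_of_injOn _ (mapsTo_P4_multiple p hP4 hP3 hpP3 hpm hpt) (injOn_P4_multiple p)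
      (divFam_finite _ _ _ _ _ _)
  · exact ncard_le_mul_ncard_of_fibre (hfin.subset (Set.sep_subset _ _)) (divFam_finite _ _ _ _ _ _) _
      (mapsTo_P4_prim p hP4 hP3 hpP4 hpP3 hpm hpt) 3 (fun b hb => fibre_P4_prim p hpP4 (hb.imp fun _ h => h.1))
  · exact ncard_le_mul_ncard_of_fibre (hfin.subset (Set.sep_subset _ _)) (divFam_finite _ _ _ _ _ _) _
      (mapsTo_P4_imprim p hP4 hP3 hpP4 hpP3 hpm hpt) (p + 1) (fun b hb => fibre_P4_imprim p hpP4 (hb.imp fun _ h => h.1))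

end Steps

/-! ### The recursion over the primes of `d₃` and of `d₄` -/

section Recursion

open Finset
open Literature.NumberTheory.Sieve.FriedlanderIwaniecPrimesSquarefree (squarefree_prod_of_primes)

variable {s : ℤ} {m : ℕ} {P4 : Finset ℕ}

/-- **Peeling all the primes of `P₃`**: `#divFam(Y, t, P₃) ≤ 3^{|P₃|} · #divFam(Y/d₃², t·d₃, ∅)`, `d₃ = ∏ P₃`.
[cite: BhargavaTaniguchiThorne2023, §5 (proof of Prop. 5.1: the overring of index d₃, multiplicity 3^{ω(d₃)})] -/
theorem ncard_divFam_P3_all (hP4 : ∀ ℓ ∈ P4, ℓ.Prime) (P3 : Finset ℕ) :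
    ∀ (Y : ℝ) (t : ℕ), (∀ ℓ ∈ P3, ℓ.Prime) → Disjoint P4 P3 → m.Coprime (∏ ℓ ∈ P3, ℓ) → t.Coprime (∏ ℓ ∈ P3, ℓ) →
      (divFam s Y m t P4 P3).ncard ≤
        3 ^ P3.card * (divFam s (Y / ((∏ ℓ ∈ P3, ℓ : ℕ) : ℝ) ^ 2) m (t * ∏ ℓ ∈ P3, ℓ) P4 ∅).ncard := by
  classical
  refine Finset.induction_on P3 ?_ ?_
  · intro Y t _ _ _ _
    simp
  · intro p P3' hp3 ih Y t hprime hdisj hm ht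
    have hp : p.Prime := hprime p (Finset.mem_insert_self p P3')
    haveI := Fact.mk hp
    have hprime' : ∀ ℓ ∈ P3', ℓ.Prime := fun ℓ hℓ => hprime ℓ (Finset.mem_insert_of_mem hℓ)
    rw [Finset.prod_insert hp3] at hm ht
    have hpP4 : p ∉ P4 := fun h => Finset.disjoint_left.mp hdisj h (Finset.mem_insert_self p P3')
    have hdisj' : Disjoint P4 P3' := Finset.disjoint_of_subset_right (Finset.subset_insert p P3') hdisj
    have hpt : p.Coprime t := (Nat.coprime_mul_iff_right.mp ht).1.symm
    have hpm : p.Coprime m := (Nat.coprime_mul_iff_right.mp hm).1.symm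
    have h1 := ncard_divFam_P3_step (s := s) (Y := Y) (m := m) (t := t) (P4 := P4) (P3 := insert p P3') p hP4 hprime
      (Finset.mem_insert_self p P3') hpP4 hpm hpt
    rw [Finset.erase_insert hp3] at h1
    -- coprimality of `t p` with `∏ P3'`
    have hpP3' : p.Coprime (∏ ℓ ∈ P3', ℓ) :=
      Nat.Coprime.prod_right fun ℓ hℓ => (Nat.coprime_primes hp (hprime' ℓ hℓ)).mpr (fun h => hp3 (h ▸ hℓ))
    have h2 := ih (Y / (p : ℝ) ^ 2) (t * p) hprime' hdisj' (Nat.coprime_mul_iff_right.mp hm).2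
      (Nat.Coprime.mul_left (Nat.coprime_mul_iff_right.mp ht).2 hpP3')
    rw [Finset.card_insert_of_notMem hp3, pow_succ, Finset.prod_insert hp3]
    have heq : divFam s (Y / (p : ℝ) ^ 2 / ((∏ ℓ ∈ P3', ℓ : ℕ) : ℝ) ^ 2) m (t * p * ∏ ℓ ∈ P3', ℓ) P4 ∅ =
        divFam s (Y / ((p * ∏ ℓ ∈ P3', ℓ : ℕ) : ℝ) ^ 2) m (t * (p * ∏ ℓ ∈ P3', ℓ)) P4 ∅ := by
      rw [div_div, ← mul_pow, mul_assoc]; push_cast; rfl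
    rw [heq] at h2
    calc ((divFam s Y m t P4 (insert p P3')).ncard : ℕ)
        ≤ 3 * (divFam s (Y / (p : ℝ) ^ 2) m (t * p) P4 P3').ncard := h1
      _ ≤ 3 * (3 ^ P3'.card * (divFam s (Y / ((p * ∏ ℓ ∈ P3', ℓ : ℕ) : ℝ) ^ 2) m (t * (p * ∏ ℓ ∈ P3', ℓ)) P4 ∅).ncard) :=
          Nat.mul_le_mul_left 3 h2
      _ = 3 ^ P3'.card * 3 * (divFam s (Y / ((p * ∏ ℓ ∈ P3', ℓ : ℕ) : ℝ) ^ 2) m (t * (p * ∏ ℓ ∈ P3', ℓ)) P4 ∅).ncard := by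
          ring

/-- `ω(m p) = ω(m) + 1` for a prime `p ∤ m`. [folklore] -/
theorem card_primeFactors_mul_prime {m p : ℕ} (hm : m ≠ 0) (hp : p.Prime) (hpm : ¬ p ∣ m) :
    (m * p).primeFactors.card = m.primeFactors.card + 1 := by
  rw [Nat.primeFactors_mul hm hp.ne_zero, hp.primeFactors, Finset.card_union_of_disjoint, Finset.card_singleton]
  exact Finset.disjoint_singleton_right.mpr fun h => hpm (Nat.dvd_of_mem_primeFactors h)

/-- A divisor of a product of distinct primes splits off coprimely: if `m · ∏P ∣ ∏P₀` then `m ⊥ ∏P`. [folklore] -/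
theorem coprime_of_mul_dvd_prod_primes {P₀ P : Finset ℕ} (hP₀ : ∀ ℓ ∈ P₀, ℓ.Prime) {m : ℕ}
    (h : m * ∏ ℓ ∈ P, ℓ ∣ ∏ ℓ ∈ P₀, ℓ) : m.Coprime (∏ ℓ ∈ P, ℓ) :=
  (Nat.squarefree_mul_iff.mp ((squarefree_prod_of_primes hP₀).squarefree_of_dvd h)).1

/-- **The abstract `P₄`-recursion.** Let `F Y m P` be real numbers (think: the size of `divFam s Y m t P ∅`, or a
sum of such sizes) defined for `P ⊆ P₀` (a fixed finite set of primes) and `m · ∏P ∣ ∏P₀`, satisfying the three-case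
step of `ncard_divFam_P4_step` at every `p ∈ P`, and the terminal bound `F Y m ∅ ≤ A · b^{ω(m)} · Y/m²` whenever
`K m^{10} ≤ Y`. Then `F Y m P ≤ A · b^{ω(m)} (3b + 2)^{|P|} · Y/(m² (∏P)⁴)` whenever `K m^{10} (∏P)^{16} ≤ Y`: per
prime the three cases cost `p⁻⁴ + 3b·p⁻⁴ + (p+1)p⁻⁶ ≤ (3b+2) p⁻⁴` (BTT: "`1/(c₂² c₁³ d_{4c}² d_{4n}³ d₃⁴ d₂⁵)` …
`N/(c₂^{10} c₁⁷ d_{4c}⁸ d_{4n}⁷ D₃⁶ d₂⁷)`", the exponent `7 = 3 + 4` at the primes of `d₄`).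
[cite: BhargavaTaniguchiThorne2023, §5 (proof of Prop. 5.1: the bookkeeping of the exponents at d_{4c}, d_{4n})] -/
theorem abstract_recursion_P4 (F : ℝ → ℕ → Finset ℕ → ℝ) {A b K : ℝ} (hA : 0 ≤ A) (hb : 1 ≤ b) (hK : 0 ≤ K)
    (P₀ : Finset ℕ) (hP₀ : ∀ ℓ ∈ P₀, ℓ.Prime)
    (hstep : ∀ (Y : ℝ) (m : ℕ) (P : Finset ℕ) (p : ℕ), P ⊆ P₀ → p ∈ P → m * ∏ ℓ ∈ P, ℓ ∣ ∏ ℓ ∈ P₀, ℓ →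
      F Y m P ≤ F (Y / (p : ℝ) ^ 4) m (P.erase p) + 3 * F (Y / (p : ℝ) ^ 2) (m * p) (P.erase p) +
        ((p : ℝ) + 1) * F (Y / (p : ℝ) ^ 6) m (P.erase p))
    (Ycap : ℝ)
    (hterm : ∀ (Y : ℝ) (m : ℕ), m ∣ ∏ ℓ ∈ P₀, ℓ → K * (m : ℝ) ^ 10 ≤ Y → Y ≤ Ycap →
      F Y m ∅ ≤ A * b ^ m.primeFactors.card * Y / (m : ℝ) ^ 2)
    (P : Finset ℕ) :
    ∀ (Y : ℝ) (m : ℕ), P ⊆ P₀ → m * ∏ ℓ ∈ P, ℓ ∣ ∏ ℓ ∈ P₀, ℓ →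
      K * (m : ℝ) ^ 10 * ((∏ ℓ ∈ P, ℓ : ℕ) : ℝ) ^ 16 ≤ Y → Y ≤ Ycap →
      F Y m P ≤ A * b ^ m.primeFactors.card * (3 * b + 2) ^ P.card * Y / ((m : ℝ) ^ 2 * ((∏ ℓ ∈ P, ℓ : ℕ) : ℝ) ^ 4) := by
  classical
  have hP₀0 : ∏ ℓ ∈ P₀, ℓ ≠ 0 := Finset.prod_ne_zero_iff.mpr fun ℓ hℓ => (hP₀ ℓ hℓ).ne_zero
  refine Finset.induction_on P ?_ ?_
  · intro Y m _ hm hY hYc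
    simp only [Finset.prod_empty, Nat.cast_one, one_pow, mul_one, Finset.card_empty, pow_zero] at hY hm ⊢
    exact hterm Y m hm hY hYc
  · intro p P' hpP' ih Y m hsub hdvd hY hYc
    have hp : p.Prime := hP₀ p (hsub (Finset.mem_insert_self p P'))
    have hsub' : P' ⊆ P₀ := (Finset.subset_insert p P').trans hsub
    have hstep1 := hstep Y m (insert p P') p hsub (Finset.mem_insert_self p P') hdvd
    rw [Finset.erase_insert hpP'] at hstep1
    rw [Finset.prod_insert hpP'] at hdvd hY
    rw [Finset.prod_insert hpP', Finset.card_insert_of_notMem hpP']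
    have hm0 : m ≠ 0 := fun h => hP₀0 (by
      rw [h, zero_mul] at hdvd; exact (zero_dvd_iff.mp hdvd))
    -- the divisibilities for the recursive calls
    have hdvd1 : m * ∏ ℓ ∈ P', ℓ ∣ ∏ ℓ ∈ P₀, ℓ := (Dvd.intro p (by ring)).trans hdvd
    have hdvd2 : m * p * ∏ ℓ ∈ P', ℓ ∣ ∏ ℓ ∈ P₀, ℓ := by rw [mul_assoc]; exact hdvd
    have hcop : m.Coprime (p * ∏ ℓ ∈ P', ℓ) := by
      have h := coprime_of_mul_dvd_prod_primes (P := insert p P') hP₀ (by rw [Finset.prod_insert hpP']; exact hdvd)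
      rwa [Finset.prod_insert hpP'] at h
    obtain ⟨hmp, hmP'⟩ := Nat.coprime_mul_iff_right.mp hcop
    have hpm : ¬ p ∣ m := fun h => hp.one_lt.ne' (hmp.symm.eq_one_of_dvd h)
    -- real quantities
    set Pr : ℝ := ((∏ ℓ ∈ P', ℓ : ℕ) : ℝ) with hPr
    have hp2 : (2 : ℝ) ≤ p := by exact_mod_cast hp.two_le
    have hp0 : (0 : ℝ) < p := by linarith
    have hPr0 : (0 : ℝ) < Pr := by
      rw [hPr]; exact_mod_cast Finset.prod_pos fun ℓ hℓ => (hP₀ ℓ (hsub' hℓ)).pos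
    have hm0r : (0 : ℝ) < m := by exact_mod_cast Nat.pos_of_ne_zero hm0
    have hY0 : 0 ≤ Y := le_trans (by positivity) hY
    have hcast : (((p * ∏ ℓ ∈ P', ℓ : ℕ) : ℕ) : ℝ) = (p : ℝ) * Pr := by rw [hPr]; push_cast; ring
    rw [hcast] at hY ⊢
    -- thresholds for the three recursive calls
    have hp1 : (1 : ℝ) ≤ p := by linarith
    have hth : ∀ k : ℕ, k ≤ 16 → K * (m : ℝ) ^ 10 * Pr ^ 16 ≤ Y / (p : ℝ) ^ k := by
      intro k hk
      rw [le_div_iff₀ (pow_pos hp0 k)]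
      calc K * (m : ℝ) ^ 10 * Pr ^ 16 * (p : ℝ) ^ k ≤ K * (m : ℝ) ^ 10 * Pr ^ 16 * (p : ℝ) ^ 16 := by
            refine mul_le_mul_of_nonneg_left (pow_le_pow_right₀ hp1 hk) (by positivity)
        _ = K * (m : ℝ) ^ 10 * ((p : ℝ) * Pr) ^ 16 := by ring
        _ ≤ Y := hY
    have hth2 : K * ((m * p : ℕ) : ℝ) ^ 10 * Pr ^ 16 ≤ Y / (p : ℝ) ^ 2 := by
      rw [le_div_iff₀ (pow_pos hp0 2)]
      calc K * ((m * p : ℕ) : ℝ) ^ 10 * Pr ^ 16 * (p : ℝ) ^ 2 = K * (m : ℝ) ^ 10 * Pr ^ 16 * (p : ℝ) ^ 12 := by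
            push_cast; ring
        _ ≤ K * (m : ℝ) ^ 10 * Pr ^ 16 * (p : ℝ) ^ 16 := by
            refine mul_le_mul_of_nonneg_left (pow_le_pow_right₀ hp1 (by norm_num)) (by positivity)
        _ = K * (m : ℝ) ^ 10 * ((p : ℝ) * Pr) ^ 16 := by ring
        _ ≤ Y := hY
    have hcap : ∀ k : ℕ, Y / (p : ℝ) ^ k ≤ Ycap := fun k =>
      (div_le_self hY0 (one_le_pow₀ hp1)).trans hYc
    have ih1 := ih (Y / (p : ℝ) ^ 4) m hsub' hdvd1 (hth 4 (by norm_num)) (hcap 4)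
    have ih2 := ih (Y / (p : ℝ) ^ 2) (m * p) hsub' hdvd2 hth2 (hcap 2)
    have ih3 := ih (Y / (p : ℝ) ^ 6) m hsub' hdvd1 (hth 6 (by norm_num)) (hcap 6)
    rw [card_primeFactors_mul_prime hm0 hp hpm] at ih2
    -- the common quantity `C`
    set C : ℝ := A * b ^ m.primeFactors.card * (3 * b + 2) ^ P'.card * Y / ((m : ℝ) ^ 2 * Pr ^ 4 * (p : ℝ) ^ 4)
      with hC
    have hC0 : 0 ≤ C := by rw [hC]; positivity
    have e1 : A * b ^ m.primeFactors.card * (3 * b + 2) ^ P'.card * (Y / (p : ℝ) ^ 4) / ((m : ℝ) ^ 2 * Pr ^ 4) = C := by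
      rw [hC]; field_simp
    have e2 : A * b ^ (m.primeFactors.card + 1) * (3 * b + 2) ^ P'.card * (Y / (p : ℝ) ^ 2) /
        (((m * p : ℕ) : ℝ) ^ 2 * Pr ^ 4) = b * C := by
      rw [hC]; push_cast; field_simp; ring
    have e3 : A * b ^ m.primeFactors.card * (3 * b + 2) ^ P'.card * (Y / (p : ℝ) ^ 6) / ((m : ℝ) ^ 2 * Pr ^ 4) =
        C / (p : ℝ) ^ 2 := by
      rw [hC]; field_simp
    rw [e1] at ih1
    rw [e2] at ih2
    rw [e3] at ih3
    have egoal : A * b ^ m.primeFactors.card * (3 * b + 2) ^ (P'.card + 1) * Y / ((m : ℝ) ^ 2 * ((p : ℝ) * Pr) ^ 4) =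
        (3 * b + 2) * C := by
      rw [hC]; field_simp; ring
    rw [egoal]
    have hlast : ((p : ℝ) + 1) * (C / (p : ℝ) ^ 2) ≤ C := by
      rw [← mul_div_assoc, div_le_iff₀ (pow_pos hp0 2)]
      have : (p : ℝ) + 1 ≤ (p : ℝ) ^ 2 := by nlinarith
      calc ((p : ℝ) + 1) * C ≤ (p : ℝ) ^ 2 * C := mul_le_mul_of_nonneg_right this hC0
        _ = C * (p : ℝ) ^ 2 := by ring
    calc F Y m (insert p P')
        ≤ F (Y / (p : ℝ) ^ 4) m P' + 3 * F (Y / (p : ℝ) ^ 2) (m * p) P' + ((p : ℝ) + 1) * F (Y / (p : ℝ) ^ 6) m P' := hstep1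
      _ ≤ C + 3 * (b * C) + ((p : ℝ) + 1) * (C / (p : ℝ) ^ 2) := by gcongr
      _ ≤ C + 3 * (b * C) + C := by linarith
      _ = (3 * b + 2) * C := by ring

end Recursion

/-! ### The shape of the large-height terminal count -/

/-- **The large-height terminal count, with constants `(C, K)`** — the SHAPE of the input supplied by BTT Thm 2.4
(cases `Φ_p`, `Φ_{p²}`) with Thm 3.2 (a predicate with parameters; nothing is asserted): for `α = ±1`, coprime
squarefree `m, d` prime to `6`, and `Y ≥ K (m² d)⁵`, the orbits with `0 < α Disc < Y`, `m² ∣ Disc`, `d ∣ Disc` number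
at most `C 4^{ω(md)} Y/(m² d)` (the role of BTT Prop. 4.7, "`≪ X/q`" for cubefree `q < X^{1/4−ε}`, in the range
`N > Q^{100}` of the proof of Prop. 5.1). [cite: BhargavaTaniguchiThorne2023, Prop. 4.7 and §5 (N > Q^{100})] -/
def DivCountBound (C K : ℝ) : Prop :=
  ∀ α : ℤ, (α = 1 ∨ α = -1) → ∀ m d : ℕ, Squarefree m → Squarefree d → m.Coprime d → (m * d).Coprime 6 →
    ∀ Y : ℝ, K * ((m : ℝ) ^ 2 * d) ^ 5 ≤ Y →
      ((divFam α Y m d ∅ ∅).ncard : ℝ) ≤ C * 4 ^ (m * d).primeFactors.card * Y / ((m : ℝ) ^ 2 * d)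

end Literature.NumberTheory.CubicFields

end
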